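import Literature.NumberTheory.EllipticCurves.CMNewformGamma0PrimitiveIsNewformProofs
import Literature.NumberTheory.EllipticCurves.CuspFormLFunctionFrickeProofs
import Literature.NumberTheory.Automorphic.BCDTModularity
import Mathlib.GroupTheory.PGroup
import HarnessLib

/-!
# STUB-IDEAS companion, `stub_modThree` (S1a), ideator k = 1, GENERATION 11 — crux `FreyModularity` (stmt-ABC-11340), route `DefiniteXi`

Family 1 (RECOGNISE & IMPORT), one level down from gen 10.  Gen 10 (`STUB_IDEAS_stub_modThree_1_g10`) reduced the 2-GROUP half
`TwoGroupBranch` of the stub to BSD-lane bricks E0–E5 plus ONE residual named fact,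
`shimura1972_heckeTheta_isNewform0_of_primitive` (the primitive CM theta series is a newform of level EXACTLY `|d_K|·N𝔣`).

WHAT CHANGED IN THE TREE SINCE GEN 10 (landed 2026-08-31T23:27Z, `CMNewformGamma0PrimitiveIsNewformProofs.lean`, sorry-free):
`shimura1972_heckeTheta_isNewform0_of_primitive_of_heckeFE : Hecke_functionalEquation_infinityType_conductor → shimura1972_…`
(Li's newness criterion against the conjugate form).  Reading its proof: the Hecke-FE fact is used ONLY to manufacture
`hFE : ∃ W Λ Λ', Λ ∈ cont_N(g) ∧ Λ' ∈ cont_N(g^ρ) ∧ Λ(s) = W·Λ'(k−s)` (Step C, file lines 739–818).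

THIS FILE (gen 11):
* T1 (swap, kernel-checked): `twoGroupBranch_of_heckeFE`, `stubModThree_of_surj_of_heckeFE` — the residual is now the analytic named fact
  `Hecke_functionalEquation_infinityType_conductor` (used at `m = 1` only).
* T2 (better, dischargeable in-tree): `hFE` follows from the FRICKE TRANSFORM of the theta series, `w_N g = c • g^ρ`
  (`HeckeThetaFrickePrimitive`, H3), by Hecke 1936 for `Γ₀(N)` — `exists_completedCuspFormL_functional_equation_holds` (PROVED, all `k`) —
  plus uniqueness of entire continuations: `fe_conj_of_fricke_eq_smul` (H1, PROVED here).  Hence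
  `HeckeThetaFrickePrimitive → shimura1972_heckeTheta_isNewform0_of_primitive` (H4, kernel-checked modulo the refactor stub H2), with NO
  Größencharakter `L`-function analysis at all; H3 itself is a theta-inversion + Gauss-sum computation over the tree's `BinaryTheta` engine.
`sorry` only in: H2 (`isNewform0_of_heckeTheta_primitive_of_fe`, a mechanical refactor of the landed tree proof), H3
(`heckeThetaFrickePrimitive_holds`, the real analytic target), and the RESTATED earlier nodes (`twoGroupBranch_of_shimura` = gen-10 E3+E5 composition;
H0 `isOdd_of_isTorsionGaloisRep_three`, N1 `surjective_or_isPGroup_two`, proved in the gen-2 / gen-6 companions) — restated because crux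
workfiles are not built on the farm, so `STUB_IDEAS_stub_modThree_1_g10` cannot be imported; every composition is kernel-checked.
-/

noncomputable section

set_option linter.dupNamespace false

open scoped NumberField ModularForm MatrixGroups ComplexConjugate
open NumberField IsDedekindDomain CongruenceSubgroup Complex
open Literature.NumberTheory.EllipticCurves Literature.NumberTheory.EllipticCurves.ModularForms
open Literature.NumberTheory.GaloisRepresentations Literature.NumberTheory.LFunctions Literature.NumberTheory.Automorphic

namespace Summit.ABC.ABC.Cruxes.FreyModularity.Sketch.StubModThreeIdeasK1G11

/-! ## The registered stub and its two halves (verbatim from the gen-7/gen-10 companions) -/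

/-- The registered stub S1a, verbatim. -/
def StubModThree : Prop :=
  ∀ (W : WeierstrassCurve ℚ) [W.IsElliptic] (ρ : ModPGaloisRep ℚ (ZMod 3) 2),
    W.IsTorsionGaloisRep 3 ρ → FramedRep.IsAbsolutelyIrreducible ρ → ρ.IsModular

/-- The surjective (octahedral) half — Langlands–Tunnell, blocked-on the 8 LT leaves (R1, frozen). -/
def StubModThreeSurj : Prop :=
  ∀ (W : WeierstrassCurve ℚ) [W.IsElliptic] (ρ : ModPGaloisRep ℚ (ZMod 3) 2),
    W.IsTorsionGaloisRep 3 ρ → Function.Surjective ρ → ρ.IsModular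

/-- The 2-group (normaliser-of-Cartan) half of the stub as typed. -/
def TwoGroupBranch : Prop :=
  ∀ (W : WeierstrassCurve ℚ) [W.IsElliptic] (ρ : ModPGaloisRep ℚ (ZMod 3) 2),
    W.IsTorsionGaloisRep 3 ρ → FramedRep.IsAbsolutelyIrreducible ρ →
    IsPGroup 2 ρ.toMonoidHom.range → ρ.IsModular

/-- RESTATED gen-10 node (PLAN D¹⁰ʙ = E3 `arithHalfThree_of_isPGroup_two` + E5 `isModular_of_arithHalfThree`; composition kernel-checked in
`STUB_IDEAS_stub_modThree_1_g10.lean`, E3/E5 open there). -/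
theorem twoGroupBranch_of_shimura (hSh : shimura1972_heckeTheta_isNewform0_of_primitive) : TwoGroupBranch := by
  sorry

/-- **H0** (PROVED, gen-2 companion; restated): `ρ̄_{E,3}` is odd. -/
theorem isOdd_of_isTorsionGaloisRep_three (W : WeierstrassCurve ℚ) [W.IsElliptic]
    (ρ : ModPGaloisRep ℚ (ZMod 3) 2) (hρ : W.IsTorsionGaloisRep 3 ρ) : FramedGaloisRep.IsOdd ρ := by
  sorry

/-- **N1** (PROVED, gen-6 companion l. 421; restated): irreducible odd `ρ̄ : G_ℚ → GL₂(𝔽₃)` is onto or has 2-group image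
(Serre 1972 Prop. 15 / `|GL₂(𝔽₃)| = 48`). -/
theorem surjective_or_isPGroup_two (ρ : ModPGaloisRep ℚ (ZMod 3) 2)
    (hirr : FramedRep.IsIrreducible ρ) (hodd : FramedGaloisRep.IsOdd ρ) :
    Function.Surjective ρ ∨ IsPGroup 2 ρ.toMonoidHom.range := by
  sorry

/-- The stub is the conjunction of its two halves (kernel-checked modulo H0, N1). -/
theorem stubModThree_of_surj_of_twoGroup (hS : StubModThreeSurj) (hT : TwoGroupBranch) : StubModThree := by
  intro W _ ρ hρ habs
  rcases surjective_or_isPGroup_two ρ habs.isIrreducible (isOdd_of_isTorsionGaloisRep_three W ρ hρ) with hs | h2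
  · exact hS W ρ hρ hs
  · exact hT W ρ hρ habs h2

/-! ## H1 — from a Fricke relation to Li's functional equation against the conjugate form (PROVED) -/

/-- `aₙ(c • f) = c · aₙ(f)` on `Γ₀(N)`. -/
theorem cuspCoeff_smul_gamma0 {N : ℕ} {k : ℤ} (c : ℂ) (f : CuspForm (Gamma0 N) k) (n : ℕ) :
    cuspCoeff (c • f) n = c * cuspCoeff f n := by
  rw [← cuspCoeffₗ_apply (one_mem_strictPeriods_coe_gamma0 N) n, map_smul, smul_eq_mul, cuspCoeffₗ_apply]

/-- `Λ_N(c • f, s) = c · Λ_N(f, s)` (raw products). -/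
theorem completedCuspFormL_smul {M : ℕ} {k : ℤ} (N : ℕ) (c : ℂ) (f : CuspForm (Gamma0 M) k) (s : ℂ) :
    completedCuspFormL N (c • f) s = c * completedCuspFormL N f s := by
  have hcoef : cuspCoeff (c • f) = c • cuspCoeff f := funext fun n ↦ by
    rw [Pi.smul_apply, smul_eq_mul, cuspCoeff_smul_gamma0]
  unfold completedCuspFormL cuspFormLSeries
  rw [hcoef, LSeries_smul]
  ring

/-- Scalar multiples of entire continuations are entire continuations of the scalar multiple. -/
theorem smul_mem_completedCuspFormLContinuations {M : ℕ} {k : ℤ} {N : ℕ} {f : CuspForm (Gamma0 M) k} {Λ : ℂ → ℂ}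
    (hΛ : Λ ∈ completedCuspFormLContinuations N f) (c : ℂ) :
    (fun s ↦ c * Λ s) ∈ completedCuspFormLContinuations N (c • f) := by
  refine ⟨(differentiable_const c).mul hΛ.1, fun s hs ↦ ?_⟩
  show c * Λ s = _
  rw [hΛ.2 s hs, completedCuspFormL_smul]

/-- **H1 (PROVED).** If `w_N g = c • g'` then `Λ_N(g, s) = W·Λ_N(g', k − s)` for the entire continuations, `W = iᵏ·c`:
Hecke 1936 (`exists_completedCuspFormL_functional_equation_holds`, all weights) + uniqueness of entire continuations.  With
`g' = epsConj0 g` this is literally the `hFE` of `isNewform0_of_heckeTheta_primitive_of_heckeFE` (Step C). -/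
theorem fe_conj_of_fricke_eq_smul {N : ℕ} [NeZero N] {k : ℤ} {g g' : CuspForm (Gamma0 N) k} {c : ℂ}
    (h : frickeInvolution N k g = c • g') :
    ∃ (W : ℂ) (Λ Λ' : ℂ → ℂ), Λ ∈ completedCuspFormLContinuations N g ∧
      Λ' ∈ completedCuspFormLContinuations N g' ∧ ∀ s : ℂ, Λ s = W * Λ' (k - s) := by
  obtain ⟨Λ, hΛ, Λ', hΛ', hfe⟩ := exists_completedCuspFormL_functional_equation_holds (N := N) k g
  obtain ⟨Λ₂, hΛ₂, -⟩ := exists_completedCuspFormL_functional_equation_holds (N := N) k g'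
  rw [h] at hΛ'
  have heq : Λ' = fun s ↦ c * Λ₂ s :=
    subsingleton_completedCuspFormLContinuations N (c • g') hΛ' (smul_mem_completedCuspFormLContinuations hΛ₂ c)
  refine ⟨Complex.I ^ k * c, Λ, Λ₂, hΛ, hΛ₂, fun s ↦ ?_⟩
  rw [hfe s, heq, mul_assoc]

/-! ## H2 — the refactor of the landed tree proof: newness from the `hFE`-shaped functional equation (stub, M, mechanical) -/

/-- **H2 (stub; mechanical refactor).**  `isNewform0_of_heckeTheta_primitive_of_heckeFE` with its first hypothesis
`hHecke : Hecke_functionalEquation_infinityType_conductor` replaced by the ONE thing it is used for, the functional equation `hFE`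
against `epsConj0 g`.  Proof for the prover: copy the tree proof (lines 572–742: Steps A, B and `set g' := epsConj0 g; hconj`) verbatim and
finish with the same `exact isNewform0_of_functionalEquation_conj hh hM₀ hT h1 hmul … hconj hFE`; Step C disappears.  Best landed as a
refactor of `CMNewformGamma0PrimitiveIsNewformProofs.lean` itself (the `_of_heckeFE` theorem then becomes a 30-line corollary). -/
theorem isNewform0_of_heckeTheta_primitive_of_fe {K : Type} [Field K] [NumberField K]
    (hK2 : Module.finrank ℚ K = 2) (htc : IsTotallyComplex K) (σ : K →+* ℂ) (k : ℕ) (hk : 2 ≤ k)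
    (𝔣 : Ideal (𝓞 K)) (h𝔣 : 𝔣 ≠ ⊥) (ψ : HeightOneSpectrum (𝓞 K) → ℂ)
    (hψG : IsGrossencharakter 𝔣 (fun w => ((k : ℤ) - 1) * embType σ w) (fun w => ((k : ℤ) - 1) * embTypeConj σ w) ψ)
    (hprim : ∀ (𝔣₁ : Ideal (𝓞 K)) (ψ₁ : HeightOneSpectrum (𝓞 K) → ℂ), 𝔣 ≤ 𝔣₁ →
      (∀ v : HeightOneSpectrum (𝓞 K), ¬ 𝔣 ≤ v.asIdeal → ψ₁ v = ψ v) →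
      IsGrossencharakter 𝔣₁ (fun w => ((k : ℤ) - 1) * embType σ w) (fun w => ((k : ℤ) - 1) * embTypeConj σ w) ψ₁ → 𝔣₁ = 𝔣)
    (hneb : ∀ n : ℕ, Odd n → n.Coprime ((discr K).natAbs * Ideal.absNorm 𝔣) →
      idealPow K ψ (Ideal.span {(n : 𝓞 K)}) = (jacobiSym (discr K) n : ℂ) * (n : ℂ) ^ (k - 1))
    {N₀ : ℕ} [NeZero N₀] (hN₀def : N₀ = (discr K).natAbs * Ideal.absNorm 𝔣) (g : CuspForm (Gamma0 N₀) (k : ℤ))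
    (hcoeff : ∀ n : ℕ, 0 < n → cuspCoeff g n = ∑ᶠ J ∈ {J : Ideal (𝓞 K) | Ideal.absNorm J = n}, rayClassCoeff 𝔣 ψ J)
    (hFE : ∃ (W : ℂ) (Λ Λ' : ℂ → ℂ), Λ ∈ completedCuspFormLContinuations N₀ g ∧
      Λ' ∈ completedCuspFormLContinuations N₀ (epsConj0 g) ∧ ∀ s : ℂ, Λ s = W * Λ' (((k : ℤ) : ℂ) - s)) :
    IsNewform0 g := by
  sorry

/-- **H2F (kernel-checked modulo H2).** Newness of the primitive theta series from its FRICKE relation `w_N g = c • g^ρ`. -/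
theorem isNewform0_of_heckeTheta_primitive_of_fricke {K : Type} [Field K] [NumberField K]
    (hK2 : Module.finrank ℚ K = 2) (htc : IsTotallyComplex K) (σ : K →+* ℂ) (k : ℕ) (hk : 2 ≤ k)
    (𝔣 : Ideal (𝓞 K)) (h𝔣 : 𝔣 ≠ ⊥) (ψ : HeightOneSpectrum (𝓞 K) → ℂ)
    (hψG : IsGrossencharakter 𝔣 (fun w => ((k : ℤ) - 1) * embType σ w) (fun w => ((k : ℤ) - 1) * embTypeConj σ w) ψ)
    (hprim : ∀ (𝔣₁ : Ideal (𝓞 K)) (ψ₁ : HeightOneSpectrum (𝓞 K) → ℂ), 𝔣 ≤ 𝔣₁ →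
      (∀ v : HeightOneSpectrum (𝓞 K), ¬ 𝔣 ≤ v.asIdeal → ψ₁ v = ψ v) →
      IsGrossencharakter 𝔣₁ (fun w => ((k : ℤ) - 1) * embType σ w) (fun w => ((k : ℤ) - 1) * embTypeConj σ w) ψ₁ → 𝔣₁ = 𝔣)
    (hneb : ∀ n : ℕ, Odd n → n.Coprime ((discr K).natAbs * Ideal.absNorm 𝔣) →
      idealPow K ψ (Ideal.span {(n : 𝓞 K)}) = (jacobiSym (discr K) n : ℂ) * (n : ℂ) ^ (k - 1))
    {N₀ : ℕ} [NeZero N₀] (hN₀def : N₀ = (discr K).natAbs * Ideal.absNorm 𝔣) (g : CuspForm (Gamma0 N₀) (k : ℤ))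
    (hcoeff : ∀ n : ℕ, 0 < n → cuspCoeff g n = ∑ᶠ J ∈ {J : Ideal (𝓞 K) | Ideal.absNorm J = n}, rayClassCoeff 𝔣 ψ J)
    {c : ℂ} (hc : frickeInvolution N₀ (k : ℤ) g = c • epsConj0 g) :
    IsNewform0 g :=
  isNewform0_of_heckeTheta_primitive_of_fe hK2 htc σ k hk 𝔣 h𝔣 ψ hψG hprim hneb hN₀def g hcoeff (fe_conj_of_fricke_eq_smul hc)

/-! ## H3 — the recognisable analytic target: the Fricke transform of a PRIMITIVE CM theta series (Hecke 1926/27) -/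

/-- **H-F = H3 (the new residual, dischargeable in-tree).**  For a PRIMITIVE Größencharakter `ψ mod 𝔣` of type `σ^{k−1}` of an imaginary
quadratic field with the `Γ₀`-Nebentypus clause, the theta series `g = θ_ψ ∈ S_k(Γ₀(|d_K|·N𝔣))` satisfies `w_N g = c • g^ρ`
(`g^ρ = epsConj0 g = Σ āₙ qⁿ = θ_{ψ̄}`); classically `c = i^{−k}·W(ψ)`, `W(ψ)` the Gauss-sum root number.  Binders = those of
`shimura1972_heckeTheta_isNewform0_of_primitive` verbatim; only the conclusion differs.  Primitivity IS needed (an imprimitive theta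
is an old-form combination whose `w_N`-image is not proportional to its conjugate). -/
def HeckeThetaFrickePrimitive : Prop :=
  ∀ (K : Type) [Field K] [NumberField K], Module.finrank ℚ K = 2 → IsTotallyComplex K →
    ∀ (σ : K →+* ℂ) (k : ℕ), 2 ≤ k →
    ∀ (𝔣 : Ideal (𝓞 K)), 𝔣 ≠ ⊥ →
    ∀ (ψ : HeightOneSpectrum (𝓞 K) → ℂ),
      IsGrossencharakter 𝔣 (fun w => ((k : ℤ) - 1) * embType σ w) (fun w => ((k : ℤ) - 1) * embTypeConj σ w) ψ →
      (∀ (𝔣₁ : Ideal (𝓞 K)) (ψ₁ : HeightOneSpectrum (𝓞 K) → ℂ), 𝔣 ≤ 𝔣₁ →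
        (∀ v : HeightOneSpectrum (𝓞 K), ¬ 𝔣 ≤ v.asIdeal → ψ₁ v = ψ v) →
        IsGrossencharakter 𝔣₁ (fun w => ((k : ℤ) - 1) * embType σ w) (fun w => ((k : ℤ) - 1) * embTypeConj σ w) ψ₁ → 𝔣₁ = 𝔣) →
      (∀ n : ℕ, Odd n → n.Coprime ((discr K).natAbs * Ideal.absNorm 𝔣) →
        idealPow K ψ (Ideal.span {(n : 𝓞 K)}) = (jacobiSym (discr K) n : ℂ) * (n : ℂ) ^ (k - 1)) →
      ∀ [NeZero ((discr K).natAbs * Ideal.absNorm 𝔣)] (g : CuspForm (Gamma0 ((discr K).natAbs * Ideal.absNorm 𝔣)) (k : ℤ)),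
        (∀ n : ℕ, 0 < n → cuspCoeff g n = ∑ᶠ J ∈ {J : Ideal (𝓞 K) | Ideal.absNorm J = n}, rayClassCoeff 𝔣 ψ J) →
        ∃ c : ℂ, frickeInvolution ((discr K).natAbs * Ideal.absNorm 𝔣) (k : ℤ) g = c • epsConj0 g

/-- **H3a (PROVED): the Fricke relation is a statement about `q`-expansions.**  It suffices to compute the Fourier coefficients of
`w_N g`: `aₙ(w_N g) = c · conj (aₙ g)` for all `n` (q-expansion principle on `Γ₀(N)` + `cuspCoeff_epsConj0`). -/
theorem fricke_eq_smul_epsConj0_of_cuspCoeff {N : ℕ} [NeZero N] {k : ℤ} {g : CuspForm (Gamma0 N) k} {c : ℂ}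
    (h : ∀ n : ℕ, cuspCoeff (frickeInvolution N k g) n = c * conj (cuspCoeff g n)) :
    frickeInvolution N k g = c • epsConj0 g :=
  eq_of_forall_cuspCoeff_eq_gamma0 fun n ↦ by rw [h n, cuspCoeff_smul_gamma0, cuspCoeff_epsConj0]

/-- **H3 (stub, M–L; the analytic core).**  Hecke's computation: `w_N = S ∘ (τ ↦ Nτ)` on each coset theta piece
`Θ_e[k/M; 0](u, (Mτ)·B)` of `θ_ψ` (`HeckeThetaCMNewformGamma0Holds.exists_heckeTheta_cuspForm_pow`) is the inversion law
`BinaryTheta.iteratedDeriv_line_inv` / `iteratedDeriv_line_slash_S_mem_span` (dual lattice `𝔟⁻¹𝔡⁻¹ = 𝔟̄/(N𝔟·√d_K)`, characteristic swap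
`[a; b] ↦ [−b; a]`), followed by re-expansion of the shifted characteristics over residues mod `𝔣` = a Gauss sum of `ψ` restricted to
`(𝓞_K/𝔣)ˣ`, which for PRIMITIVE `ψ` factorises as `τ(ψ_f)·ψ̄_f(x)` — H3b: the finite part `ψ_f(x) = ψ̃((x))·σ(x)^{-e}` as a
`MulChar (𝓞 K ⧸ 𝔣) ℂ` (Mathlib `gaussSum_mulShift` for the unit separation; the vanishing on non-units for primitive characters is the tree's
`RayClassGaussSum(Norm)` argument, there written for sign-type finite-order characters and to be re-run for a general `MulChar`) — and the
class re-indexing `𝔞 ↦ 𝔞̄⁻¹𝔣⁻¹𝔡⁻¹`;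
then H3a.  Printed: Hecke 1926 §3, Hecke 1927; inversion with characteristics Andrianov–Zhuravlev Prop. 3.14 / Lemma 3.15 (3.33);
Miyake Thm. 4.8.2 (proof, via the converse theorem: `f_ψ ∣ ω_N = C·f_{ψ̄}`). -/
theorem heckeThetaFrickePrimitive_holds : HeckeThetaFrickePrimitive := by
  sorry

/-! ## H4 — the residual named fact from H3 (kernel-checked modulo H2) and the gen-11 assemblies -/

/-- **H4.** `HeckeThetaFrickePrimitive → shimura1972_heckeTheta_isNewform0_of_primitive` (the gen-10 residual), modulo the refactor H2. -/
theorem shimura1972_of_fricke (hF : HeckeThetaFrickePrimitive) : shimura1972_heckeTheta_isNewform0_of_primitive := by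
  intro K _ _ hK2 htc σ k hk 𝔣 h𝔣 ψ hψG hprim hneb _ g hcoeff
  obtain ⟨c, hc⟩ := hF K hK2 htc σ k hk 𝔣 h𝔣 ψ hψG hprim hneb g hcoeff
  exact isNewform0_of_heckeTheta_primitive_of_fricke hK2 htc σ k hk 𝔣 h𝔣 ψ hψG hprim hneb rfl g hcoeff hc

/-- **T1 (swap, kernel-checked over the gen-10 companion):** the 2-group half from Hecke's functional equation with conductor
(the landed `shimura1972_heckeTheta_isNewform0_of_primitive_of_heckeFE`). -/
theorem twoGroupBranch_of_heckeFE (h : Hecke_functionalEquation_infinityType_conductor) : TwoGroupBranch :=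
  twoGroupBranch_of_shimura (shimura1972_heckeTheta_isNewform0_of_primitive_of_heckeFE h)

/-- **T2 (kernel-checked modulo H2 + gen-10 E0–E5):** the 2-group half from the Fricke transform of primitive CM theta series. -/
theorem twoGroupBranch_of_fricke (hF : HeckeThetaFrickePrimitive) : TwoGroupBranch :=
  twoGroupBranch_of_shimura (shimura1972_of_fricke hF)

/-- ★ The stub as typed = (surjective/octahedral half: Langlands–Tunnell, frozen) + (2-group half: residual = Hecke FE with conductor). -/
theorem stubModThree_of_surj_of_heckeFE (hS : StubModThreeSurj) (h : Hecke_functionalEquation_infinityType_conductor) :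
    StubModThree :=
  stubModThree_of_surj_of_twoGroup hS (twoGroupBranch_of_heckeFE h)

/-- ★★ The stub as typed = (surjective half, frozen) + (2-group half: residual = the Fricke transform H3, dischargeable in-tree). -/
theorem stubModThree_of_surj_of_fricke (hS : StubModThreeSurj) (hF : HeckeThetaFrickePrimitive) : StubModThree :=
  stubModThree_of_surj_of_twoGroup hS (twoGroupBranch_of_fricke hF)

/-- Sanity: `StubModThree` is literally the registered stub `stub_modThree`. -/
example (h : StubModThree) : ∀ (W : WeierstrassCurve ℚ) [W.IsElliptic] (ρ : ModPGaloisRep ℚ (ZMod 3) 2),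
    W.IsTorsionGaloisRep 3 ρ → FramedRep.IsAbsolutelyIrreducible ρ → ρ.IsModular := h

end Summit.ABC.ABC.Cruxes.FreyModularity.Sketch.StubModThreeIdeasK1G11
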